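import Literature.MathematicalPhysics.QuantumFieldTheory.King1986.SlicePropagatorStatements

/-!
# King 1986 I, §3.3 pp. 664–665 AS PRINTED, in KING'S QUANTIFIER ORDER: Propositions 3.8 (3.71) and 3.9 (3.73)–(3.75) at ONE
# Hölder exponent `α` — «for 0 < α < 1, and γ sufficiently small» (γ chosen AFTER α) — and their bridges to the schemas of
# `King1986/SlicePropagatorStatements` (v1.1 of that inventory, filed as a LEAF so that the statements file and its ≈ 180
# transitive importers stay byte-identical)

statement-level skeleton of published theorems with citation tags; proofs where landed; nothing here is a claim about the Yang–Mills mass gap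

C. King, *The U(1) Higgs model. I. The continuum limit*, Commun. Math. Phys. **102** (1986) 649–677 [King1986], §3.3 pp. 664–665.
PDF held: `paper:king1986-cmp102-king-u1-higgs-i` (journal page = PDF page + 648); p. 664 [PDF 16] l. 40 *"Proposition 3.8. For
x′, y′ ∈ T_{η′}, 0 < α < 1, and γ sufficiently small,"* and p. 665 [PDF 17] l. 12 *"Proposition 3.9. For 0 ≤ j ≤ k − 1, 0 < α < 1,
and γ sufficiently small,"* read from the held text layer (renders `run/shared/lean/pub/pub-balaban/b2b-balaban-template/king-renders/
1986-cmp102-king-u1-higgs-I-p016-x2.png`, `…-p017-x2.png`).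

CITATION HEADER (lean-in-tree rule).  Typed for the cell `lit-balaban` (typer seat, D-0062 desk) on the SCHEMA NOTE of pub-ymgap
`dag-n15-d` g16 (2026-08-28T12:45:18Z, lit-balaban INBOX; first raised by `dag-n15-e` g15, 2026-08-27): the landed schemas
`SlicePropagator.Prop38Printed T C δ₀ γ` and `SlicePropagator.Prop39Printed T C δ₀ γ` (`SlicePropagatorStatements` :216–231,
:252–276) put the Hölder exponent INSIDE — `… ∧ ∀ α, 0 < α → α < 1 → …` — so an inhabitant must serve ALL `α ∈ (0, 1)` with ONE
`(C, δ₀, γ)`.  Print quantifies the other way: King fixes `α` (the norms of Theorem 3.3) and then takes «γ sufficiently small»;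
the complementary exponent is what the two-spacing gain of the Hölder quotient can use (the tree's `A = 0` theorems
`King1986/MinimizerHolderDecay` :344 `(hαγ : α + γ ≤ 1)`, :562 `(α + γ < 1)` carry exactly this coupling), so the
family-uniform reading is STRONGER than print and is not expected to be inhabited by King's own model uniformly in `k`.
WHAT THIS LEAF ADDS (definitions with bodies + bookkeeping, all PROVED; the two landed schemas are untouched):
* §1 **`Prop38PrintedAt α T C δ₀ γ`** — the text of `Prop38Printed` with `α` a PARAMETER (lines 1–2 of (3.71) are `α`-free, lines
  3–4 are the Hölder lines at THIS `α`); `prop38PrintedAt_of_prop38Printed`; ★ `prop38Printed_iff_forall`: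
  `Prop38Printed T C δ₀ γ ↔ ∀ α ∈ (0, 1), Prop38PrintedAt α T C δ₀ γ`.
* §2 **`Prop39PrintedAt α T C δ₀ γ`** — the same for (3.73)–(3.75); `prop39PrintedAt_of_prop39Printed`; ★ `prop39Printed_iff_forall`.
* §3 the print-order consumer shape, stated once as a definition so that users quantify as King does:
  `Prop38KingOrder T := ∀ α ∈ (0, 1), ∃ C δ₀ γ, 0 < γ ∧ Prop38PrintedAt α T C δ₀ γ` (and `Prop39KingOrder`), with the one-line
  facts `prop38KingOrder_of_prop38Printed` ∕ `prop39KingOrder_of_prop39Printed` (the family-uniform schema implies the print-order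
  one whenever its `γ > 0`).
The pub-ymgap tree already carries a Summit-side mirror `Summit.…Theorems.BalabanUVNodesN15KingModelCurvedHTorusProp38.Prop38PrintedAt`
(p628279) with the SAME body; it is definitionally equal to §1's predicate (`Iff.rfl` after unfolding), so its `A = 0` inhabitant
(`prop38PrintedAt_kingTwoSpacingH`, p630124) transfers by name.  Literature does not import Summits, hence the restatement here,
at the statements' home.
HONEST SCOPE.  Hypothesis schemas only (King proves 3.8/3.9 in §4 of [K I]); King's operators with `A ≠ 0` are not constructed;
nothing here bears on Bałaban's 4-d Yang–Mills papers, infinite volume, a mass gap, or the Clay problem; count-neutral for the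
ladder (no node discharged).  0 `sorry`; net new unproved facts: 0 (every `def` below is a hypothesis SCHEMA with a body, named
for consumers to quantify — not a vendored fact — exactly as `Prop38Printed` ∕ `Prop39Printed` of the parent file).
-/

noncomputable section

open Real

namespace Literature.MathematicalPhysics.QuantumFieldTheory.King1986.SlicePropagator

/-! ## §1 Proposition 3.8 (3.71) at a fixed Hölder exponent -/

/-- **PROPOSITION 3.8 (3.71) AT ONE HÖLDER EXPONENT `α`**, p. 664 [PDF 16], verbatim: *"Proposition 3.8. For x′, y′ ∈ T_{η′},
0 < α < 1, and γ sufficiently small, |a_{k+n}G^{η′}_{k+n}Q^*_{k+n}(x′, z) − a_kG^η_kQ^*_k(x, z)|, |a_{k+n}∂^{η′}_μG^{η′}_{k+n}Q^*_{k+n}(x′, z)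
− a_k∂^η_μG^η_kQ^*_k(x, z)|, |(∂_α(x′, y′)a_{k+n}G^{η′}_{k+n}Q^*_{k+n})(z) − (∂_α(x, y)a_kG^η_kQ^*_k)(z)|, |(∂_α(x′, y′)a_{k+n}∂^{η′}_μ
G^{η′}_{k+n}Q^*_{k+n})(z) − (∂_α(x, y)a_k∂^η_μG^η_kQ^*_k)(z)| ≤ CL^{−γk} exp[−δ₀{|x − z|, dist({x, y}, z)}]. (3.71)"*  The SAME four
lines as `Prop38Printed T C δ₀ γ` (same data, same constants, `z ∈ T^{(k)}`, Hölder lines for `x′ ≠ y′`, `x ≠ y`), with the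
exponent `α` a PARAMETER instead of the inner `∀ α ∈ (0, 1)` — King's order «0 < α < 1, and γ sufficiently small»: `γ` (and `C`,
`δ₀`) may depend on `α`.  HYPOTHESIS SCHEMA. [cite: King1986, Prop 3.8 (3.71) p.664] -/
def Prop38PrintedAt {d : ℕ} (α : ℝ) (T : TwoSpacing d) (C δ₀ γ : ℝ) : Prop :=
  (∀ (x' : T.hi.S) (z : T.lo.S), T.IsUnit z →
    |T.K' x' z - T.K (T.pt x') z| ≤ C * (T.lo.L : ℝ) ^ (-(γ * T.lo.k)) * Real.exp (-(δ₀ * T.lo.dist (T.pt x') z)) ∧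
    ∀ μ : Fin d, |T.dK' μ x' z - T.dK μ (T.pt x') z|
      ≤ C * (T.lo.L : ℝ) ^ (-(γ * T.lo.k)) * Real.exp (-(δ₀ * T.lo.dist (T.pt x') z))) ∧
  (∀ (x' y' : T.hi.S) (z : T.lo.S), T.IsUnit z → 0 < T.hi.dist x' y' →
    0 < T.lo.dist (T.pt x') (T.pt y') →
    |holderDeriv T.hi.dist α T.K' x' y' z - holderDeriv T.lo.dist α T.K (T.pt x') (T.pt y') z|
        ≤ C * (T.lo.L : ℝ) ^ (-(γ * T.lo.k))
          * Real.exp (-(δ₀ * min (T.lo.dist (T.pt x') z) (T.lo.dist (T.pt y') z))) ∧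
    ∀ μ : Fin d, |holderDeriv T.hi.dist α (T.dK' μ) x' y' z - holderDeriv T.lo.dist α (T.dK μ) (T.pt x') (T.pt y') z|
        ≤ C * (T.lo.L : ℝ) ^ (-(γ * T.lo.k))
          * Real.exp (-(δ₀ * min (T.lo.dist (T.pt x') z) (T.lo.dist (T.pt y') z))))

/-- From the family-uniform schema to every fixed exponent: `Prop38Printed T C δ₀ γ → Prop38PrintedAt α T C δ₀ γ` for
`0 < α < 1` (bookkeeping). [cite: King1986, Prop 3.8 (3.71) p.664] -/
theorem prop38PrintedAt_of_prop38Printed {d : ℕ} {T : TwoSpacing d} {C δ₀ γ : ℝ} (h : Prop38Printed T C δ₀ γ) {α : ℝ}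
    (hα0 : 0 < α) (hα1 : α < 1) : Prop38PrintedAt α T C δ₀ γ :=
  ⟨h.1, h.2 α hα0 hα1⟩

/-- ★ **The schema as landed IS the conjunction of its fixed-exponent forms**:
`Prop38Printed T C δ₀ γ ↔ ∀ α ∈ (0, 1), Prop38PrintedAt α T C δ₀ γ` (the `α`-free lines 1–2 are read off at `α = ½`).  Hence a
by-name inhabitant of `Prop38Printed` must serve ALL `α ∈ (0, 1)` with ONE `(C, δ₀, γ)` — stronger than print's «γ sufficiently
small» given `α` (bookkeeping). [cite: King1986, Prop 3.8 (3.71) p.664] -/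
theorem prop38Printed_iff_forall {d : ℕ} (T : TwoSpacing d) (C δ₀ γ : ℝ) :
    Prop38Printed T C δ₀ γ ↔ ∀ α : ℝ, 0 < α → α < 1 → Prop38PrintedAt α T C δ₀ γ := by
  refine ⟨fun h α hα0 hα1 => prop38PrintedAt_of_prop38Printed h hα0 hα1,
    fun h => ⟨(h (1 / 2) one_half_pos one_half_lt_one).1, fun α hα0 hα1 => (h α hα0 hα1).2⟩⟩

/-! ## §2 Proposition 3.9 (3.73)–(3.75) at a fixed Hölder exponent -/

/-- **PROPOSITION 3.9 (3.73)–(3.75) AT ONE HÖLDER EXPONENT `α`**, p. 665 [PDF 17], verbatim: *"Proposition 3.9. For 0 ≤ j ≤ k − 1,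
0 < α < 1, and γ sufficiently small, |G^{η′}_{(j)}(x′, y′) − G^η_{(j)}(x, y)|, |∂^{η′}_μG^{η′}_{(j)}(x′, y′) − ∂^η_μG^η_{(j)}(x, y)| ≤
CL^{−γk}{(L^jη)^{2−d−γ}, (L^jη)^{1−d−γ}} exp[−δ₀(L^jη)^{−1}|x − y|], (3.73) |G^{η′}_{(j)}(Γ^{(j+n+1)}_{x_{j+n+1},x′}, b′) −
G^η_{(j)}(Γ^{(j+1)}_{x_{j+1},x}, b)| ≤ CL^{−γk}(L^jη)^{3−d−γ} exp[−δ₀(L^jη)^{−1} dist(B^j(x), b)], (3.74) |(∂_α(x′, y′)G^{η′}_{(j)})(z′) −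
(∂_α(x, y)G^η_{(j)})(z)|, |(∂_α(x′, y′)∂^{η′}_μG^{η′}_{(j)})(z′) − (∂_α(x, y)∂^η_μG^η_{(j)})(z)| ≤ CL^{−γk}{(L^jη)^{2−d−α−γ}, (L^jη)^{1−d−α−γ}}
exp[−δ₀ dist({x, y}, z)]. (3.75)"*  The SAME displays as `Prop39Printed T C δ₀ γ` (same `TwoSpacing` data, `x = pt x′` etc., slice
lengths of the coarse lattice, (3.75) without the factor `(L^jη)^{−1}` in the exponential, as printed), for every slice
`0 ≤ j ≤ k − 1`, with the exponent `α` a PARAMETER instead of the inner `∀ α ∈ (0, 1)` — King's order «0 < α < 1, and γ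
sufficiently small».  HYPOTHESIS SCHEMA. [cite: King1986, Prop 3.9 (3.73)–(3.75) p.665] -/
def Prop39PrintedAt {d : ℕ} (α : ℝ) (T : TwoSpacing d) (C δ₀ γ : ℝ) : Prop :=
  ∀ j : ℕ, j + 1 ≤ T.lo.k →
    (∀ x' y' : T.hi.S,
      |T.hi.G j x' y' - T.lo.G j (T.pt x') (T.pt y')|
          ≤ C * (T.lo.L : ℝ) ^ (-(γ * T.lo.k)) * (T.lo.slice j) ^ ((2 : ℝ) - d - γ)
            * Real.exp (-(δ₀ * (T.lo.slice j)⁻¹ * T.lo.dist (T.pt x') (T.pt y'))) ∧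
      ∀ μ : Fin d, |T.hi.dG j μ x' y' - T.lo.dG j μ (T.pt x') (T.pt y')|
          ≤ C * (T.lo.L : ℝ) ^ (-(γ * T.lo.k)) * (T.lo.slice j) ^ ((1 : ℝ) - d - γ)
            * Real.exp (-(δ₀ * (T.lo.slice j)⁻¹ * T.lo.dist (T.pt x') (T.pt y')))) ∧
    (∀ (x' : T.hi.S) (b' : T.hi.B),
      |T.hi.Gc j x' b' - T.lo.Gc j (T.pt x') (T.bd b')|
          ≤ C * (T.lo.L : ℝ) ^ (-(γ * T.lo.k)) * (T.lo.slice j) ^ ((3 : ℝ) - d - γ)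
            * Real.exp (-(δ₀ * (T.lo.slice j)⁻¹ * T.lo.distBlockBond j (T.pt x') (T.bd b')))) ∧
    (∀ x' y' z' : T.hi.S, 0 < T.hi.dist x' y' → 0 < T.lo.dist (T.pt x') (T.pt y') →
      |holderDeriv T.hi.dist α (T.hi.G j) x' y' z' - holderDeriv T.lo.dist α (T.lo.G j) (T.pt x') (T.pt y') (T.pt z')|
          ≤ C * (T.lo.L : ℝ) ^ (-(γ * T.lo.k)) * (T.lo.slice j) ^ ((2 : ℝ) - d - α - γ)
            * Real.exp (-(δ₀ * min (T.lo.dist (T.pt x') (T.pt z')) (T.lo.dist (T.pt y') (T.pt z')))) ∧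
      ∀ μ : Fin d,
        |holderDeriv T.hi.dist α (T.hi.dG j μ) x' y' z' - holderDeriv T.lo.dist α (T.lo.dG j μ) (T.pt x') (T.pt y') (T.pt z')|
          ≤ C * (T.lo.L : ℝ) ^ (-(γ * T.lo.k)) * (T.lo.slice j) ^ ((1 : ℝ) - d - α - γ)
            * Real.exp (-(δ₀ * min (T.lo.dist (T.pt x') (T.pt z')) (T.lo.dist (T.pt y') (T.pt z')))))

/-- From the family-uniform schema to every fixed exponent: `Prop39Printed T C δ₀ γ → Prop39PrintedAt α T C δ₀ γ` for
`0 < α < 1` (bookkeeping). [cite: King1986, Prop 3.9 (3.73)–(3.75) p.665] -/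
theorem prop39PrintedAt_of_prop39Printed {d : ℕ} {T : TwoSpacing d} {C δ₀ γ : ℝ} (h : Prop39Printed T C δ₀ γ) {α : ℝ}
    (hα0 : 0 < α) (hα1 : α < 1) : Prop39PrintedAt α T C δ₀ γ :=
  fun j hj => ⟨(h j hj).1, (h j hj).2.1, (h j hj).2.2 α hα0 hα1⟩

/-- ★ **The schema as landed IS the conjunction of its fixed-exponent forms**:
`Prop39Printed T C δ₀ γ ↔ ∀ α ∈ (0, 1), Prop39PrintedAt α T C δ₀ γ` (the `α`-free lines (3.73)–(3.74) are read off at `α = ½`)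
(bookkeeping). [cite: King1986, Prop 3.9 (3.73)–(3.75) p.665] -/
theorem prop39Printed_iff_forall {d : ℕ} (T : TwoSpacing d) (C δ₀ γ : ℝ) :
    Prop39Printed T C δ₀ γ ↔ ∀ α : ℝ, 0 < α → α < 1 → Prop39PrintedAt α T C δ₀ γ := by
  refine ⟨fun h α hα0 hα1 => prop39PrintedAt_of_prop39Printed h hα0 hα1, fun h j hj => ?_⟩
  refine ⟨(h (1 / 2) one_half_pos one_half_lt_one j hj).1, (h (1 / 2) one_half_pos one_half_lt_one j hj).2.1,
    fun α hα0 hα1 => (h α hα0 hα1 j hj).2.2⟩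

/-! ## §3 The print-order consumer shape: «for 0 < α < 1, and γ sufficiently small» -/

/-- **PROPOSITION 3.8 IN KING'S QUANTIFIER ORDER**, p. 664 [PDF 16] *"0 < α < 1, and γ sufficiently small"*: for every Hölder
exponent `α ∈ (0, 1)` there are constants `C, δ₀` and a rate `γ > 0` (all allowed to depend on `α`) with (3.71) at this `α`.
The shape a consumer of Proposition 3.8 should quantify (King uses one `α`, that of Theorem 3.3's norms); `δ₀ > 0`, `C`'s
dependence *"on g, h"* and uniformity in `k` are the consumer's to add for its family of data, as for `Prop38Printed`.
HYPOTHESIS SCHEMA (shape). [cite: King1986, Prop 3.8 (3.71) p.664] -/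
def Prop38KingOrder {d : ℕ} (T : TwoSpacing d) : Prop :=
  ∀ α : ℝ, 0 < α → α < 1 → ∃ C δ₀ γ : ℝ, 0 < γ ∧ Prop38PrintedAt α T C δ₀ γ

/-- **PROPOSITION 3.9 IN KING'S QUANTIFIER ORDER**, p. 665 [PDF 17] *"0 < α < 1, and γ sufficiently small"*: for every
`α ∈ (0, 1)` there are `C, δ₀` and `γ > 0` with (3.73)–(3.75) at this `α`.  HYPOTHESIS SCHEMA (shape).
[cite: King1986, Prop 3.9 (3.73)–(3.75) p.665] -/
def Prop39KingOrder {d : ℕ} (T : TwoSpacing d) : Prop :=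
  ∀ α : ℝ, 0 < α → α < 1 → ∃ C δ₀ γ : ℝ, 0 < γ ∧ Prop39PrintedAt α T C δ₀ γ

/-- The family-uniform schema with a positive rate implies the print-order one (one `(C, δ₀, γ)` for all `α`) (bookkeeping).
[cite: King1986, Prop 3.8 (3.71) p.664] -/
theorem prop38KingOrder_of_prop38Printed {d : ℕ} {T : TwoSpacing d} {C δ₀ γ : ℝ} (hγ : 0 < γ)
    (h : Prop38Printed T C δ₀ γ) : Prop38KingOrder T :=
  fun _ hα0 hα1 => ⟨C, δ₀, γ, hγ, prop38PrintedAt_of_prop38Printed h hα0 hα1⟩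

/-- The family-uniform schema with a positive rate implies the print-order one (bookkeeping).
[cite: King1986, Prop 3.9 (3.73)–(3.75) p.665] -/
theorem prop39KingOrder_of_prop39Printed {d : ℕ} {T : TwoSpacing d} {C δ₀ γ : ℝ} (hγ : 0 < γ)
    (h : Prop39Printed T C δ₀ γ) : Prop39KingOrder T :=
  fun _ hα0 hα1 => ⟨C, δ₀, γ, hγ, prop39PrintedAt_of_prop39Printed h hα0 hα1⟩

/-! ## §4 (v1.1) Proposition 3.7 (3.63)–(3.65) at a fixed Hölder exponent — «0 < α < 1, and all 0 ≤ j ≤ k − 1» -/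

/-- **PROPOSITION 3.7 (3.63)–(3.65) AT ONE HÖLDER EXPONENT `α`**, p. 663 [PDF 15], verbatim: *"Proposition 3.7. For x, y, z ∈ T_η,
0 < α < 1, and all 0 ≤ j ≤ k − 1, |G^η_{(j)}(x, y)|, |∂^η_μG^η_{(j)}(x, y)| ≤ C{(L^jη)^{2−d}, (L^jη)^{1−d}}·exp[−δ₀(L^jη)^{−1}|x − y|], (3.63)
|G^η_{(j)}(Γ^{(j+1)}_{x_{j+1},x}, b)| ≤ C(L^jη)^{3−d} exp[−δ₀(L^jη)^{−1} dist(B^j(x), b)], (3.64) |∂_α(x, y)G^η_{(j)}(z)|,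
|∂_α(x, y)∂^η_μG^η_{(j)}(z)| ≤ C{(L^jη)^{2−d−α}, (L^jη)^{1−d−α}} exp[−δ₀(L^jη)^{−1} dist({x, y}, z)]. (3.65) … Proposition 3.7 follows
immediately from Theorem 3.3 and the scaling properties of the operators."*  The SAME displays as `Prop37Printed D C δ₀`
(`SlicePropagatorStatements` :161–175: same data, same constants, `dist({x, y}, z) = min(|x − z|, |y − z|)`, the Hölder clause for
`x ≠ y`, every slice `j + 1 ≤ k`), with the exponent `α` a PARAMETER instead of the inner `∀ α ∈ (0, 1)`: (3.63)–(3.64) are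
`α`-free, (3.65) is read at THIS `α` — King's «C» is generic (that of Theorem 3.3's norms at the chosen `α`), so `C`, `δ₀` may
depend on `α`.  (v1.1, on the SCHEMA NOTE of pub-ymgap `dag-n15-e` g17, 2026-08-28T16:48:37Z: the gradient Hölder clause (3.65)₂
of King's own `A = 0` slices has `C = C(α)`, `δ₀ = δ₀(α)` — the tree's `King1986/MinimizerHolderDecayUniform.holder_dkernel_decay_blocks_unif`
— so the family-uniform `Prop37Printed` is stronger than print there; the value clause tolerates uniformity.)  HYPOTHESIS SCHEMA.
[cite: King1986, Prop 3.7 (3.63)–(3.65) p.663] -/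
def Prop37PrintedAt {d : ℕ} (α : ℝ) (D : SliceKernels d) (C δ₀ : ℝ) : Prop :=
  ∀ j : ℕ, j + 1 ≤ D.k →
    (∀ x y : D.S,
      |D.G j x y| ≤ C * (D.slice j) ^ ((2 : ℝ) - d) * Real.exp (-(δ₀ * (D.slice j)⁻¹ * D.dist x y)) ∧
      ∀ μ : Fin d, |D.dG j μ x y| ≤ C * (D.slice j) ^ ((1 : ℝ) - d) * Real.exp (-(δ₀ * (D.slice j)⁻¹ * D.dist x y))) ∧
    (∀ (x : D.S) (b : D.B),
      |D.Gc j x b| ≤ C * (D.slice j) ^ ((3 : ℝ) - d) * Real.exp (-(δ₀ * (D.slice j)⁻¹ * D.distBlockBond j x b))) ∧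
    (∀ x y z : D.S, 0 < D.dist x y →
      |holderDeriv D.dist α (D.G j) x y z|
          ≤ C * (D.slice j) ^ ((2 : ℝ) - d - α) * Real.exp (-(δ₀ * (D.slice j)⁻¹ * min (D.dist x z) (D.dist y z))) ∧
      ∀ μ : Fin d, |holderDeriv D.dist α (D.dG j μ) x y z|
          ≤ C * (D.slice j) ^ ((1 : ℝ) - d - α) * Real.exp (-(δ₀ * (D.slice j)⁻¹ * min (D.dist x z) (D.dist y z))))

/-- From the family-uniform schema to every fixed exponent: `Prop37Printed D C δ₀ → Prop37PrintedAt α D C δ₀` for `0 < α < 1`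
(bookkeeping). [cite: King1986, Prop 3.7 (3.63)–(3.65) p.663] -/
theorem prop37PrintedAt_of_prop37Printed {d : ℕ} {D : SliceKernels d} {C δ₀ : ℝ} (h : Prop37Printed D C δ₀) {α : ℝ}
    (hα0 : 0 < α) (hα1 : α < 1) : Prop37PrintedAt α D C δ₀ :=
  fun j hj => ⟨(h j hj).1, (h j hj).2.1, (h j hj).2.2 α hα0 hα1⟩

/-- ★ **The schema as landed IS the conjunction of its fixed-exponent forms**:
`Prop37Printed D C δ₀ ↔ ∀ α ∈ (0, 1), Prop37PrintedAt α D C δ₀` (the `α`-free displays (3.63)–(3.64) are read off at `α = ½`).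
So a by-name inhabitant of `Prop37Printed` must serve ALL `α ∈ (0, 1)` with ONE `(C, δ₀)` — stronger than print for the gradient
Hölder clause (bookkeeping). [cite: King1986, Prop 3.7 (3.63)–(3.65) p.663] -/
theorem prop37Printed_iff_forall {d : ℕ} (D : SliceKernels d) (C δ₀ : ℝ) :
    Prop37Printed D C δ₀ ↔ ∀ α : ℝ, 0 < α → α < 1 → Prop37PrintedAt α D C δ₀ := by
  refine ⟨fun h α hα0 hα1 => prop37PrintedAt_of_prop37Printed h hα0 hα1, fun h j hj => ?_⟩
  refine ⟨(h (1 / 2) one_half_pos one_half_lt_one j hj).1, (h (1 / 2) one_half_pos one_half_lt_one j hj).2.1,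
    fun α hα0 hα1 => (h α hα0 hα1 j hj).2.2⟩

/-- **PROPOSITION 3.7 IN KING'S QUANTIFIER ORDER**, p. 663 [PDF 15] *"0 < α < 1, and all 0 ≤ j ≤ k − 1"* with `C` generic (Theorem
3.3 at the chosen `α`): for every Hölder exponent `α ∈ (0, 1)` there are constants `C` and `δ₀ > 0` (allowed to depend on `α`)
with (3.63)–(3.65) at this `α` for all slices.  The shape a consumer of Proposition 3.7 should quantify; `C`'s dependence
*"on g, h"* and uniformity in `k` are the consumer's to add for its family of data, as for `Prop37Printed`.  HYPOTHESIS SCHEMA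
(shape). [cite: King1986, Prop 3.7 (3.63)–(3.65) p.663] -/
def Prop37KingOrder {d : ℕ} (D : SliceKernels d) : Prop :=
  ∀ α : ℝ, 0 < α → α < 1 → ∃ C δ₀ : ℝ, 0 < δ₀ ∧ Prop37PrintedAt α D C δ₀

/-- The family-uniform schema with a positive rate implies the print-order one (one `(C, δ₀)` for all `α`) (bookkeeping).
[cite: King1986, Prop 3.7 (3.63)–(3.65) p.663] -/
theorem prop37KingOrder_of_prop37Printed {d : ℕ} {D : SliceKernels d} {C δ₀ : ℝ} (hδ₀ : 0 < δ₀)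
    (h : Prop37Printed D C δ₀) : Prop37KingOrder D :=
  fun _ hα0 hα1 => ⟨C, δ₀, hδ₀, prop37PrintedAt_of_prop37Printed h hα0 hα1⟩

/-- The print-order shape restricted to the `α`-free displays: `Prop37KingOrder D` already yields ONE `(C, δ₀ > 0)` with (3.63) for
every slice (read at `α = ½`) — the hypothesis form of §5 of the parent file (`abs_sum_dG_le` wants (3.63)₂ only) (bookkeeping).
[cite: King1986, Prop 3.7 (3.63) p.663] -/
theorem exists_ineq363_of_prop37KingOrder {d : ℕ} {D : SliceKernels d} (h : Prop37KingOrder D) :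
    ∃ C δ₀ : ℝ, 0 < δ₀ ∧ ∀ j : ℕ, j + 1 ≤ D.k → ∀ x y : D.S,
      |D.G j x y| ≤ C * (D.slice j) ^ ((2 : ℝ) - d) * Real.exp (-(δ₀ * (D.slice j)⁻¹ * D.dist x y)) ∧
      ∀ μ : Fin d, |D.dG j μ x y| ≤ C * (D.slice j) ^ ((1 : ℝ) - d) * Real.exp (-(δ₀ * (D.slice j)⁻¹ * D.dist x y)) := by
  obtain ⟨C, δ₀, hδ₀, hAt⟩ := h (1 / 2) one_half_pos one_half_lt_one
  exact ⟨C, δ₀, hδ₀, fun j hj => (hAt j hj).1⟩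

end Literature.MathematicalPhysics.QuantumFieldTheory.King1986.SlicePropagator

end
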